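import Mathlib.GroupTheory.FreeGroup.Reduce
import Literature.Topology.FourManifolds.SphereTrisectionsSectors
import HarnessLib

/-!
# Abrams–Gay–Kirby, Thm. 5: the genus-`0` clause of the map `ℳ`, proved

Topic `Literature/Topology/FourManifolds`; sibling of `TrisectionFunctor.lean` /
`TrisectionFunctorGK.lean` / `TrisectionFunctorProofs.lean` (fact seat
`provefact-Literature.Topology.FourManifolds.exists-cd2a2fb641`, named fact (e)
`Literature.Topology.FourManifolds.exists_trisected_of_isGroupTrisection`, Abrams–Gay–Kirby 2018, Thm. 5).

## Status of fact (e), and why this file exists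

Fact (e) of `TrisectionFunctor.lean` — Abrams–Gay–Kirby's Theorem 5, the map `ℳ` from group
trisections to trisected 4-manifolds with `𝒢 ∘ ℳ = id` up to trisected isomorphism — is phrased
over the predicate `IsBalancedTrisection`, which is unsatisfiable
(`TrisectionRefutation.not_isBalancedTrisection`: its sectors are smoothly embedded manifolds *with
boundary*, which cannot meet three at a time along the non-empty central surface, whereas
Gay–Kirby's sectors have corners there).  Being an existential over that predicate, (e) is
**false as stated** — `Literature.Topology.FourManifolds.not_exists_trisected_of_isGroupTrisection`
(`TrisectionFunctorProofs.lean`) — and can never be discharged.  Its faithful restatement is (e′)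
`Literature.Topology.FourManifolds.exists_gkTrisected_of_isGroupTrisection` (`TrisectionFunctorGK.lean`, verbatim over
`IsBalancedGKTrisection`), whose printed proof (AGK pp. 1541–1542: handlebody fillings realising
the epimorphisms `S_g ↠ H_g`, Leininger–Reid and Dehn's lemma; recognition of the three boundary
3-manifolds with free `π₁` of rank `k` as `#ᵏ(S¹ × S²)` by Kneser–Stallings, Perelman and the
Sphere Theorem; unique filling by `♮ᵏ(S¹ × B³)`, Laudenbach–Poénaru) is far beyond the tree.

What is provable today is the first explicit clause of Theorem 5 (p. 1541): "The unique
`(0, 0)`-trisection of `{1}` maps to the unique `(0, 0)`-trisection of `S⁴`", i.e. the genus-`0`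
instance of (e′) in universe `0`, because Gay–Kirby's genus-`0` trisection of the round `S⁴` is
fully formalised (`sphereSector_isBalancedGKTrisection_holds`, `SphereTrisectionsSectors.lean`),
with base point and marking (`GayKirby.sphereSector_basePoint`, `GayKirby.sphereSector_marking`,
`SphereTrisections.lean`) and orientation (`isOrientable_sphere_holds`).  This file records:

* `IsFreeOfRank.eq_zero_of_subsingleton`: a subsingleton group free of rank `n` has `n = 0`;
* `TrisectionKernels.eq_trivialKernels`: every genus-`0` kernel triple is `(⊤, ⊤, ⊤)`;
* `IsGroupTrisection.eq_zero_of_genus_zero`, `IsGroupTrisection.subsingleton_of_genus_zero`: a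
  `(0, k)` group trisection of `G` has `k = 0` and `G` trivial — AGK p. 1538, "There is a unique
  `(0, 0)`-trisection of the trivial group", in the strong form that there is no other genus-`0`
  group trisection at all;
* `exists_gkTrisected_of_isGroupTrisection_genusZero`: **the genus-`0` case of (e′)** — every
  `(0, k)` group trisection `K` of a group `G` is isomorphic to (indeed equal to) the kernel triple
  of the balanced `(0, k)`-trisection of the round `S⁴ ⊆ ℝ⁵` by Gay–Kirby's sectors
  `X_j = {2πj/3 ≤ θ ≤ 2π(j+1)/3}`, a closed connected oriented smooth 4-manifold.

Nothing here changes or weakens (e) or (e′): the cases `g ≥ 1` of (e′), Theorem 5 proper, remain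
a named fact.

## References

* A. Abrams, D. Gay, R. Kirby, *Group trisections and smooth 4-manifolds*, Geom. Topol. 22 (2018)
  1537–1545 (arXiv:1605.06731): p. 1538 ("There is a unique `(0, 0)`-trisection of the trivial
  group"); Thm. 5, p. 1541; proof of Thm. 5, pp. 1541–1542.
* D. Gay, R. Kirby, *Trisecting 4-manifolds*, Geom. Topol. 20 (2016) 3097–3132 (arXiv:1205.1565):
  §2, first example (the genus-`0` trisection of `S⁴`, arXiv p. 5).
-/

noncomputable section

open Set
open scoped Manifold ContDiff

namespace Literature.Topology.FourManifolds

/-! ### Genus-`0` group trisections are the `(0, 0)`-trisection of the trivial group -/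

/-- A subsingleton group that is free of rank `n` has `n = 0` (a free group on a non-empty set of
generators is non-trivial: `FreeGroup.of a ≠ 1`). [folklore] -/
theorem IsFreeOfRank.eq_zero_of_subsingleton {H : Type*} [Group H] [Subsingleton H] {n : ℕ}
    (h : IsFreeOfRank H n) : n = 0 := by
  obtain ⟨e⟩ := h
  by_contra hn
  have h1 : FreeGroup.of (⟨0, Nat.pos_of_ne_zero hn⟩ : Fin n) = 1 :=
    e.injective (Subsingleton.elim _ _)
  exact FreeGroup.of_ne_one _ h1

/-- Every kernel triple in genus `0` is the trivial triple `(⊤, ⊤, ⊤)`, `S_0` being the trivial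
group (Abrams–Gay–Kirby, p. 1538: "There is a unique `(0, 0)`-trisection of the trivial group").
[cite: AbramsGayKirby2018, p. 1538 (the unique (0,0)-trisection of the trivial group)] -/
theorem TrisectionKernels.eq_trivialKernels (K : TrisectionKernels 0) : K = trivialKernels :=
  funext fun i => Subgroup.ext fun γ => by
    simp only [trivialKernels, Subgroup.mem_top, iff_true]
    rw [Subsingleton.elim γ 1]
    exact one_mem _

/-- A genus-`0` group trisection is a `(0, 0)`-trisection: the pairwise pushout `S_0/⟪K₀ ∪ K₁⟫`
is trivial and free of rank `k`, so `k = 0` (Abrams–Gay–Kirby, p. 1538: "There is a unique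
`(0, 0)`-trisection of the trivial group"). [cite: AbramsGayKirby2018, p. 1538 (the unique (0,0)-trisection of the trivial group)] -/
theorem IsGroupTrisection.eq_zero_of_genus_zero {k : ℕ} {G : Type*} [Group G]
    {K : TrisectionKernels 0} (hK : IsGroupTrisection 0 k G K) : k = 0 :=
  (hK.free_pairQuotient 0 1 (by decide)).eq_zero_of_subsingleton

/-- The trisected group of a genus-`0` group trisection is trivial: it is isomorphic to the triple
pushout `S_0/⟪K₀ ∪ K₁ ∪ K₂⟫ = {1}` (Abrams–Gay–Kirby, p. 1538: "There is a unique
`(0, 0)`-trisection of the trivial group"). [cite: AbramsGayKirby2018, p. 1538 (the unique (0,0)-trisection of the trivial group)] -/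
theorem IsGroupTrisection.subsingleton_of_genus_zero {k : ℕ} {G : Type*} [Group G]
    {K : TrisectionKernels 0} (hK : IsGroupTrisection 0 k G K) : Subsingleton G := by
  obtain ⟨e⟩ := hK.triple
  exact e.symm.toEquiv.subsingleton

/-! ### The genus-`0` clause of Theorem 5 -/

/-- **Abrams–Gay–Kirby, Thm. 5, genus-`0` clause of the map `ℳ` (proved): "The unique
`(0, 0)`-trisection of `{1}` maps to the unique `(0, 0)`-trisection of `S⁴`."**  Every `(0, k)`
group trisection `K` of a group `G` (necessarily `k = 0`, `K = (⊤, ⊤, ⊤)` and `G = {1}`: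
`IsGroupTrisection.eq_zero_of_genus_zero`, `TrisectionKernels.eq_trivialKernels`,
`IsGroupTrisection.subsingleton_of_genus_zero`) is isomorphic to the Abrams–Gay–Kirby kernel
triple `groupGKTrisectionOf` of a balanced `(0, k)`-trisection, with corners along the central
surface, of a closed, connected, oriented smooth 4-manifold — namely of the round unit sphere
`S⁴ ⊆ ℝ⁵` trisected by Gay–Kirby's sectors `X_j = {(re^{iθ}, x₃, x₄, x₅) | 2πj/3 ≤ θ ≤ 2π(j+1)/3}`
(`GayKirby.sphereSector`, `sphereSector_isBalancedGKTrisection_holds`; Gay–Kirby 2016, §2, first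
example), based at `e₂ ∈ F = {z = 0} ∩ S⁴ ≅ S²` with the marking `S_0 = {1} ≃* π₁(F, e₂) = {1}`
(`GayKirby.sphereSector_basePoint`, `GayKirby.sphereSector_marking`) and oriented by
`isOrientable_sphere_holds 4`; the kernel triple of any genus-`0` trisection is `(⊤, ⊤, ⊤)`
(`groupGKTrisectionOf_genus_zero`).  This is the `g = 0` instance (universe `0`; `G` in any
universe, as the conclusion does not mention `G`) of the named fact (e′)
`exists_gkTrisected_of_isGroupTrisection` (`TrisectionFunctorGK.lean`), the corrected form of the
refuted fact (e) `exists_trisected_of_isGroupTrisection` (`TrisectionFunctor.lean`;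
`not_exists_trisected_of_isGroupTrisection`, `TrisectionFunctorProofs.lean`); the cases `g ≥ 1`
are Theorem 5 proper (Dehn's lemma, Kneser–Stallings–Perelman, Laudenbach–Poénaru) and are not
proved in the tree. [cite: AbramsGayKirby2018, Thm. 5 (p. 1541)] -/
theorem exists_gkTrisected_of_isGroupTrisection_genusZero (k : ℕ) (G : Type*) [Group G]
    (K : TrisectionKernels 0) (hK : IsGroupTrisection 0 k G K) :
    ∃ (X : Type) (_ : TopologicalSpace X) (_ : T2Space X) (_ : SecondCountableTopology X)
      (_ : ChartedSpace (EuclideanSpace ℝ (Fin 4)) X) (_ : IsManifold (𝓡 4) ∞ X)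
      (_ : CompactSpace X) (_ : ConnectedSpace X) (_ : SmoothOrientation (𝓡 4) X)
      (S : Fin 3 → Set X) (h : IsBalancedGKTrisection X 0 k S) (x₀ : centralSurface S)
      (μ : SurfaceGroup 0 ≃* FundamentalGroup (centralSurface S) x₀),
      TrisectionKernels.Iso (groupGKTrisectionOf h x₀ μ) K := by
  obtain rfl : k = 0 := hK.eq_zero_of_genus_zero
  obtain ⟨o⟩ := isOrientable_sphere_holds 4
  refine ⟨Metric.sphere (0 : EuclideanSpace ℝ (Fin 5)) 1, inferInstance, inferInstance,
    inferInstance, inferInstance, inferInstance, inferInstance, inferInstance, o,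
    GayKirby.sphereSector, sphereSector_isBalancedGKTrisection_holds,
    GayKirby.sphereSector_basePoint, GayKirby.sphereSector_marking, ?_⟩
  rw [groupGKTrisectionOf_genus_zero, K.eq_trivialKernels]
  exact TrisectionKernels.Iso.refl _

end Literature.Topology.FourManifolds

end
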